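import Literature.MathematicalPhysics.QuantumFieldTheory.Balaban1983to89.T4TwoRunAfTail

/-!
# `Balaban1983to89.T4TwoRunWitnessAF` — NON-VACUITY of node U2's asymptotically free TWO-RUN closure (technique P2):
every binder of `T4TwoRunAfTail.injectedRate_of_fullScheme_primitive_afTail` (and of the ε-gap form
`injectedRate_of_fullScheme_twoRun_afTail`) inhabited AT ONCE by an explicit toy scheme on `ℝ` with non-zero
coupling-weighted memory, a non-zero scale-shift source, a POSITIVE lower bound on its β-functions, and runs of (0.20)
pinned in the infrared for EVERY number of steps; the window non-empty at explicit rationals; the controlled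
discrepancies provably non-zero.  Kernel bookkeeping; nothing about Bałaban's objects is asserted.

HONEST FRAMING (cell `pub-balaban`, T4-DAG PAGE 1).  The cell's T4 target is rung (B)+1 of its ladder — existence AND
uniqueness of the ε → 0 limit of Bałaban's unit-scale expectations on a FIXED FINITE four-torus; NOT infinite volume,
NOT the Yang–Mills mass gap, NOT the Clay problem.  This module ASSERTS NOTHING about Bałaban's β-functions, effective
actions or renormalization transformations.  The closures of node U2 certified so far (`T4TwoRunClosure` §3–§6,
`T4TwoRunAfTail` §5–§6, lineage t4-ne4-p1's `T4FlagMemoryAF.injectedRate_of_scheme_twoRun_af[_pinned]`) take some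
twenty BINDERS — the one-step scheme shapes `Represents` / `ReadLipschitz` / `StepDirect` / `StepShift`
(`T4FlagMemory` §2) and `T4FlagMemoryAF.StepMemoryFn` (all NOT PRINTED), the runs of the printed recursion (0.20) in the
box with their infrared pin (node U1/H3), the β sub-cell's eventual lower bound `EventualLowerH b γ k₀ β` with `b > 0`
(NOT discharged for Bałaban's β), and a smallness WINDOW.  The referee's objection G-t4r3-1 (seat t4-ref3-g5) showed
that one hypothesis list of this node (`T4FlagMemoryAF` §6, since relabelled) was EMPTY on asymptotically free runs:
its monotonicity hypothesis contradicts `b > 0` along (0.20).  The present leaf answers the corresponding question for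
the recommended closure — *are its binders jointly satisfiable on asymptotically free pinned runs, with non-zero memory
and non-zero source, inside the window?* — in the affirmative, by an explicit model.  It is a CONSISTENCY certificate
for hypothesis SHAPES; it says nothing about which constants Bałaban's scheme (2.13) realises (unprinted: cell GAPS
G-t4-U2R-2, `T4FlagMemory` header) and is NOT summit progress.

WHAT THIS LEAF DOES.
* (§1) The AF TOY SCHEME on `X = ℝ`: `afToy b₀ ℓ′ c ω j g y := b₀ + T4FlagMemoryAF.afStep ℓ′ c ω j g y` — a CONSTANT
  one-loop part `b₀` plus lineage t4-ne4-p1's AF-weighted linear scheme (consumed BY NAME: `afStep`, `sq1`,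
  `afStep_direct`, `afStep_memoryFn`, `sum_pow_sub_le`; nothing restated), read out by the identity; the generated
  history-dependent family `βtoy k v := entry afToy (extd v) k`.  Shapes: `represents_afToy` (rfl), `afToy_direct`
  (modulus `ℓ′ + cω(1−ω)⁻¹`), `afToy_memoryFn` (`StepMemoryFn afToy γ (c·) ω`), `afToy_shift_eq` / `afToy_shift`
  (source `cγω·ω^k`, the age-weighted unpartnered finest entry), the two-sided size `abs_entry_sub_le`, hence
  `betaLowerH_afToy` / `betaUpperH_afToy` / `eventualLowerH_afToy` (`b ≤ b₀ − cγω(1−ω)⁻¹ ≤ βtoy ≤ b₀ + ℓ′γ + cγω(1−ω)⁻¹`).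
* (§2) CONTINUITY of every flag entry in the history (strong induction on the birth step) — `FlowStep.BetaContH γ βtoy`.
* (§3) RUNS: for `b > 0`, EVERY `K` and EVERY `gIR ∈ ]0, γ]` a run of (0.20) of the toy family in the box pinned at
  `g_K = gIR`, BY NAME from `FlowStep.couplingTrajectory_exists_history` (`runs_exist`).
* (§4) END TO END: `injectedRate_afToy` feeds §1–§3 into `T4TwoRunAfTail.injectedRate_of_fullScheme_primitive_afTail`
  (and `injectedRate_afToy_gap` into the ε-gap form) BY NAME, under that theorem's window taken verbatim;
  `injectedRate_afToy_numeric`: at `(b₀, ℓ′, c, ω, ε, ν, b, k₀) = (1/2, 1/6, 1/2, 1/4, 1, 1/2, 1/4, 0)` the window holds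
  for EVERY `γ ∈ ]0, 1/16]` (`⌈c²/(bε²)⌉ = 1`, `Λ = 1 + γ/2`) and node U2's output reads `InjectedRate (5γ) 0 (3/4)`.
* (§5) NON-TRIVIALITY: `disc_pos` — for ANY pinned pair of runs of the toy family, `disc (g 1) (g 2) 0 > 0` (run B's
  second β-function carries the memory term run A's first does not; `1/x²` is strictly decreasing), so the controlled
  sequence is not zero; `βtoy_one_strictMono` — without saturation (`b₀ + ℓ′γ ≤ 1`) the second β-function is strictly
  increasing in the OLDER coupling: the toy is genuinely history-dependent, not a Markov family in disguise.
* (§6) `closure_binders_inhabited`: the closure's binder list as ONE existential statement, with `c > 0`, `src > 0`,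
  `b > 0` and `disc (g 1) (g 2) 0 > 0` added, inhabited.

WHAT IT DOES NOT DO.  It does not instantiate any shape for Bałaban's (2.13) (cell NE2/NE3/NE5/NE9 and the memory
constant — unprinted); it does not touch the (AF-0r)/tail-lower input for Bałaban's β (β sub-cell); it does not compare
the windows of the box-uniform and run-wise closures as numbers (G-t4-U2R-2: `c`, `cr`, `ℓ′` unprinted); the toy's
perturbative shape `|βtoy − b₀| = O(γ)` is NOT the cell's `FlowStep.BetaPertH` (`O(γ²)` about a k-uniform constant —
not needed by the closures witnessed here, which consume `EventualLowerH` only).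

CITATION HEADER (lean-in-tree rule 2026-08-18).  T. Bałaban, *Renormalization group approach to lattice gauge field
theories. I*, Commun. Math. Phys. **109** (1987) 249–301 [Balaban1987RG1] (cell paper B12 = [I]); T. Bałaban,
*Renormalization group approach to lattice gauge field theories. II. Cluster expansions*, Commun. Math. Phys. **116**
(1988) 1–22 [Balaban1988RG2Cluster].  Both manuscripts are UNDER ADJUDICATION: quoted for what they STATE, never as
establishing a disputed step.  NOTHING IS NEWLY QUOTED in this module: the loci behind the hypothesis shapes ([I] p. 256
(0.20), p. 259 (0.31) and Theorem 2, p. 264 (1.20)–(1.22), p. 268 (2.12)–(2.15); [II] p. 8 (1.29), p. 9 Lemma 1 (1.36))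
are quoted VERBATIM, with the renders named, in the headers of `T4TwoRunMatching`, `T4FlagMemory`, `T4FlagMemoryAF`,
`T4CouplingMatching` and `FlowStep`.  Every declaration below is tagged [folklore]: elementary real analysis about an
explicit toy recursion; no [cite:] locus is claimed.

DECLARATIONS.  (§1) `afToy`, `afToy_apply`, `βtoy`, `represents_afToy`, `afToy_direct`, `afToy_memoryFn`,
`afToy_shift_eq`, `afToy_shift`, `abs_entry_sub_le`, `betaLowerH_afToy`, `betaUpperH_afToy`, `eventualLowerH_afToy`.
(§2) `continuous_extd`, `continuous_sq1`, `continuous_entry_afToy`, `betaContH_afToy`.  (§3) `runs_exist`.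
(§4) `injectedRate_afToy`, `injectedRate_afToy_gap`, `injectedRate_afToy_numeric`.  (§5) `sq1_pos`, `sq1_eq_self`,
`βtoy_zero`, `βtoy_one`, `disc_pos`, `βtoy_one_strictMono`.  (§6) `closure_binders_inhabited`.

NEW module of unit `b2b-balaban-t4-ne4-p2` generation 5 (planner seat, NE4 technique P2 "two-trajectory comparison";
journal claim T4-U2.NE4-PROVE-P2e*, CLAIMS.log 2026-08-19); imports `T4TwoRunAfTail` (this lineage, v1.2) only and
modifies nothing; `noncomputable` real-valued toy definitions `afToy`, `βtoy` only; no `sorry`, no `axiom`.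
Companion record `t4/T4-EST-NE4-P2.md` v1.6 §13.
-/

namespace Literature.MathematicalPhysics.QuantumFieldTheory.Balaban1983to89.T4TwoRunWitnessAF

open Literature.MathematicalPhysics.QuantumFieldTheory.Balaban1983to89
open Literature.MathematicalPhysics.QuantumFieldTheory.Balaban1983to89.FlowStep
open Literature.MathematicalPhysics.QuantumFieldTheory.Balaban1983to89.T4CouplingMatching
open Literature.MathematicalPhysics.QuantumFieldTheory.Balaban1983to89.T4FlagMemory
open Literature.MathematicalPhysics.QuantumFieldTheory.Balaban1983to89.T4FlagMemoryAF
  (sq1 abs_sq1_le abs_sq1_sub_le afStep afStep_direct afStep_memoryFn sum_pow_sub_le StepMemoryFn)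
open Literature.MathematicalPhysics.QuantumFieldTheory.Balaban1983to89.T4FlagMemoryTwoRun (extd_prefixOf)
open Literature.MathematicalPhysics.QuantumFieldTheory.Balaban1983to89.T4TwoRunClosure (injectedRate_mono_const)
open Literature.MathematicalPhysics.QuantumFieldTheory.Balaban1983to89.T4TwoRunAfTail
open Finset

/-! ## §1 The asymptotically free toy scheme on `ℝ` and the β-family it generates -/

section Toy

/-- THE AF TOY SCHEME on `X = ℝ`: new entry = `b₀ + afStep ℓ′ c ω j g y` — a CONSTANT one-loop part `b₀` plus lineage
t4-ne4-p1's AF-weighted linear scheme `T4FlagMemoryAF.afStep` (direct part `ℓ′·g`, coupling-weighted fading memory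
`Σ_{m<j} c·g·ω^{j−m}·sq1(entry born at m)`), consumed BY NAME.  A caricature: used only to show that the binder list of
node U2's AF two-run closures is jointly satisfiable on asymptotically free pinned runs. [folklore] -/
noncomputable def afToy (b₀ ℓ' c ω : ℝ) : ℕ → ℝ → (ℕ → ℝ) → ℝ :=
  fun j g y => b₀ + afStep ℓ' c ω j g y

/-- Unfolding of `afToy` at full application. [folklore] -/
theorem afToy_apply (b₀ ℓ' c ω : ℝ) (j : ℕ) (g : ℝ) (y : ℕ → ℝ) :
    afToy b₀ ℓ' c ω j g y = b₀ + (ℓ' * g + ∑ m ∈ range j, c * g * ω ^ (j - m) * sq1 (y m)) := rfl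

/-- THE β-FAMILY GENERATED BY THE TOY: `βtoy k v = entry afToy (extd v) k` — the history-dependent family READ OFF the
newest entry of the flag by the identity read-out (`T4FlagMemory.Represents` with `r = id`). [folklore] -/
noncomputable def βtoy (b₀ ℓ' c ω : ℝ) : HBeta := fun k v => entry (afToy b₀ ℓ' c ω) (extd v) k

/-- `Represents afToy id γ βtoy` — by definition (any γ). [folklore] -/
theorem represents_afToy (b₀ ℓ' c ω γ : ℝ) :
    Represents (afToy b₀ ℓ' c ω) (fun x : ℝ => x) γ (βtoy b₀ ℓ' c ω) := fun _ _ _ => rfl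

/-- The toy has the direct modulus `ℓ′ + cω(1−ω)⁻¹` of `afStep` (`T4FlagMemoryAF.afStep_direct` BY NAME; the constant
`b₀` cancels in the distance). [folklore] -/
theorem afToy_direct {b₀ ℓ' c ω γ : ℝ} (hℓ' : 0 ≤ ℓ') (hc : 0 ≤ c) (hω : 0 ≤ ω) (hω1 : ω < 1) :
    StepDirect (afToy b₀ ℓ' c ω) (ℓ' + c * (ω / (1 - ω))) γ := by
  intro j g g' y h1 h2 h3 h4
  have h := afStep_direct (γ := γ) hℓ' hc hω hω1 j g g' y h1 h2 h3 h4
  rw [Real.dist_eq] at h ⊢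
  simpa only [afToy, add_sub_add_left_eq_sub] using h

/-- The toy has the coupling-weighted memory `StepMemoryFn afToy γ (c·) ω` of `afStep`
(`T4FlagMemoryAF.afStep_memoryFn` BY NAME). [folklore] -/
theorem afToy_memoryFn {b₀ ℓ' c ω γ : ℝ} (hc : 0 ≤ c) (hω : 0 ≤ ω) :
    StepMemoryFn (afToy b₀ ℓ' c ω) γ (fun x => c * x) ω := by
  intro j g y y' h1 h2
  have h := afStep_memoryFn (ℓ' := ℓ') (γ := γ) hc hω j g y y' h1 h2
  rw [Real.dist_eq] at h ⊢
  simpa only [afToy, add_sub_add_left_eq_sub] using h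

/-- THE ONE-STEP SOURCE OF THE TOY: run B's entry born at `k + 1` minus what the step-k map makes of run B's shifted flag
at the same coupling is `c·g_{k+1}·ω^{k+1}·sq1(entry 0)` — every partnered entry cancels, the unpartnered finest one
survives weighted by its age and the current coupling (as `T4FlagMemoryAF.afStep_shift_eq`, for the toy's own flag).
[folklore] -/
theorem afToy_shift_eq (b₀ ℓ' c ω : ℝ) (g : ℕ → ℝ) (k : ℕ) :
    entry (afToy b₀ ℓ' c ω) g (k + 1)
      - afToy b₀ ℓ' c ω k (g (k + 1)) (fun m => if m < k then entry (afToy b₀ ℓ' c ω) g (m + 1) else default)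
      = c * g (k + 1) * ω ^ (k + 1) * sq1 (entry (afToy b₀ ℓ' c ω) g 0) := by
  rw [entry_def, afToy_apply, afToy_apply]
  have hflag : ∑ m ∈ range (k + 1), c * g (k + 1) * ω ^ (k + 1 - m) * sq1 (flag (afToy b₀ ℓ' c ω) g (k + 1) m)
      = ∑ m ∈ range (k + 1), c * g (k + 1) * ω ^ (k + 1 - m) * sq1 (entry (afToy b₀ ℓ' c ω) g m) := by
    refine Finset.sum_congr rfl fun m hm => ?_
    rw [flag_apply, if_pos (mem_range.mp hm)]
  have hsh : ∑ m ∈ range k, c * g (k + 1) * ω ^ (k - m)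
        * sq1 (if m < k then entry (afToy b₀ ℓ' c ω) g (m + 1) else default)
      = ∑ m ∈ range k, c * g (k + 1) * ω ^ (k + 1 - (m + 1)) * sq1 (entry (afToy b₀ ℓ' c ω) g (m + 1)) := by
    refine Finset.sum_congr rfl fun m hm => ?_
    rw [if_pos (mem_range.mp hm), show k + 1 - (m + 1) = k - m by omega]
  rw [hflag, hsh,
    Finset.sum_range_succ' (fun m => c * g (k + 1) * ω ^ (k + 1 - m) * sq1 (entry (afToy b₀ ℓ' c ω) g m))]
  simp only [Nat.sub_zero]
  ring

/-- Hence the toy satisfies `StepShift` with the geometric source `src k = (cγω)·ω^k` along admissible sequences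
(`|sq1| ≤ 1`, `0 < g_{k+1} ≤ γ`; `c, ω ≥ 0`) — a NON-ZERO source whenever `c, γ, ω > 0`. [folklore] -/
theorem afToy_shift {b₀ ℓ' c ω γ : ℝ} (hc : 0 ≤ c) (hω : 0 ≤ ω) :
    StepShift (afToy b₀ ℓ' c ω) γ (fun k => c * γ * ω * ω ^ k) := by
  intro g hg k
  rw [Real.dist_eq, afToy_shift_eq, abs_mul,
    abs_of_nonneg (mul_nonneg (mul_nonneg hc (hg (k + 1)).1.le) (pow_nonneg hω _))]
  have h1 : c * g (k + 1) * ω ^ (k + 1) ≤ c * γ * ω ^ (k + 1) :=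
    mul_le_mul_of_nonneg_right (mul_le_mul_of_nonneg_left (hg (k + 1)).2 hc) (pow_nonneg hω _)
  have h2 : 0 ≤ c * g (k + 1) * ω ^ (k + 1) := mul_nonneg (mul_nonneg hc (hg (k + 1)).1.le) (pow_nonneg hω _)
  calc c * g (k + 1) * ω ^ (k + 1) * |sq1 (entry (afToy b₀ ℓ' c ω) g 0)|
      ≤ c * γ * ω ^ (k + 1) * 1 := mul_le_mul h1 (abs_sq1_le _) (abs_nonneg _) (h2.trans h1)
    _ = c * γ * ω * ω ^ k := by rw [pow_succ]; ring

/-- TWO-SIDED SIZE OF THE ENTRIES along an admissible sequence: `|entry_j − b₀ − ℓ′g_j| ≤ cγ·ω(1−ω)⁻¹`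
(`|sq1| ≤ 1`, `Σ_{m<j} ω^{j−m} ≤ ω(1−ω)⁻¹` = `T4FlagMemoryAF.sum_pow_sub_le`). [folklore] -/
theorem abs_entry_sub_le {b₀ ℓ' c ω γ : ℝ} (hc : 0 ≤ c) (hω : 0 ≤ ω) (hω1 : ω < 1) {g : ℕ → ℝ} (hg : Adm γ g)
    (j : ℕ) : |entry (afToy b₀ ℓ' c ω) g j - (b₀ + ℓ' * g j)| ≤ c * γ * (ω / (1 - ω)) := by
  rw [entry_def, afToy_apply]
  have e : b₀ + (ℓ' * g j + ∑ m ∈ range j, c * g j * ω ^ (j - m) * sq1 (flag (afToy b₀ ℓ' c ω) g j m))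
      - (b₀ + ℓ' * g j) = ∑ m ∈ range j, c * g j * ω ^ (j - m) * sq1 (flag (afToy b₀ ℓ' c ω) g j m) := by ring
  rw [e]
  refine (Finset.abs_sum_le_sum_abs _ _).trans ?_
  have hterm : ∀ m ∈ range j, |c * g j * ω ^ (j - m) * sq1 (flag (afToy b₀ ℓ' c ω) g j m)|
      ≤ c * γ * ω ^ (j - m) := by
    intro m _
    rw [abs_mul, abs_of_nonneg (mul_nonneg (mul_nonneg hc (hg j).1.le) (pow_nonneg hω _))]
    calc c * g j * ω ^ (j - m) * |sq1 (flag (afToy b₀ ℓ' c ω) g j m)|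
        ≤ c * g j * ω ^ (j - m) * 1 :=
          mul_le_mul_of_nonneg_left (abs_sq1_le _) (mul_nonneg (mul_nonneg hc (hg j).1.le) (pow_nonneg hω _))
      _ ≤ c * γ * ω ^ (j - m) * 1 :=
          mul_le_mul_of_nonneg_right
            (mul_le_mul_of_nonneg_right (mul_le_mul_of_nonneg_left (hg j).2 hc) (pow_nonneg hω _)) zero_le_one
      _ = c * γ * ω ^ (j - m) := mul_one _
  have hγ : 0 ≤ γ := (hg j).1.le.trans (hg j).2
  refine (Finset.sum_le_sum hterm).trans ?_
  rw [← Finset.mul_sum]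
  exact mul_le_mul_of_nonneg_left (sum_pow_sub_le hω hω1 j) (mul_nonneg hc hγ)

/-- LOWER BOUND of the generated family on the boxes: `b₀ − cγω(1−ω)⁻¹ ≤ βtoy k v` (`ℓ′·v_k ≥ 0`), hence
`BetaLowerH b γ βtoy` for every `b ≤ b₀ − cγω(1−ω)⁻¹` — DISCRETE ASYMPTOTIC FREEDOM of the toy when that number is
positive. [folklore] -/
theorem betaLowerH_afToy {b₀ ℓ' c ω γ b : ℝ} (hℓ' : 0 ≤ ℓ') (hc : 0 ≤ c) (hω : 0 ≤ ω) (hω1 : ω < 1)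
    (hb : b ≤ b₀ - c * γ * (ω / (1 - ω))) : BetaLowerH b γ (βtoy b₀ ℓ' c ω) := by
  intro k v hv
  have hadm : Adm γ (extd v) := extd_adm hv
  have h := (abs_le.mp (abs_entry_sub_le (b₀ := b₀) (ℓ' := ℓ') hc hω hω1 hadm k)).1
  have hk : 0 ≤ ℓ' * extd v k := mul_nonneg hℓ' (hadm k).1.le
  show b ≤ entry (afToy b₀ ℓ' c ω) (extd v) k
  linarith

/-- UPPER BOUND of the generated family on the boxes: `βtoy k v ≤ b₀ + ℓ′γ + cγω(1−ω)⁻¹`. [folklore] -/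
theorem betaUpperH_afToy {b₀ ℓ' c ω γ : ℝ} (hℓ' : 0 ≤ ℓ') (hc : 0 ≤ c) (hω : 0 ≤ ω) (hω1 : ω < 1) :
    BetaUpperH (b₀ + ℓ' * γ + c * γ * (ω / (1 - ω))) γ (βtoy b₀ ℓ' c ω) := by
  intro k v hv
  have hadm : Adm γ (extd v) := extd_adm hv
  have h := (abs_le.mp (abs_entry_sub_le (b₀ := b₀) (ℓ' := ℓ') hc hω hω1 hadm k)).2
  have hk : ℓ' * extd v k ≤ ℓ' * γ := mul_le_mul_of_nonneg_left (hadm k).2 hℓ'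
  show entry (afToy b₀ ℓ' c ω) (extd v) k ≤ _
  linarith

/-- … and the EVENTUAL lower bound `EventualLowerH b γ k₀ βtoy` from every `k₀` (the input shape of node U2's AF
closures, `T4CouplingMatching.EventualLowerH`). [folklore] -/
theorem eventualLowerH_afToy {b₀ ℓ' c ω γ b : ℝ} (hℓ' : 0 ≤ ℓ') (hc : 0 ≤ c) (hω : 0 ≤ ω) (hω1 : ω < 1)
    (hb : b ≤ b₀ - c * γ * (ω / (1 - ω))) (k₀ : ℕ) : EventualLowerH b γ k₀ (βtoy b₀ ℓ' c ω) :=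
  eventualLowerH_of_betaLowerH (betaLowerH_afToy hℓ' hc hω hω1 hb) k₀

end Toy

/-! ## §2 Continuity of the generated family in the history (the input `FlowStep.BetaContH` of the run existence) -/

section Continuity

/-- The clamped extension is continuous in the history, coordinatewise. [folklore] -/
theorem continuous_extd (k m : ℕ) : Continuous (fun v : Fin (k + 1) → ℝ => extd v m) := by
  by_cases h : m ≤ k
  · have e : (fun v : Fin (k + 1) → ℝ => extd v m) = fun v => v ⟨m, Nat.lt_succ_of_le h⟩ := by
      funext v; simp [extd, h]
    rw [e]; exact continuous_apply _
  · have e : (fun v : Fin (k + 1) → ℝ => extd v m) = fun v => v (Fin.last k) := by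
      funext v; simp [extd, h]
    rw [e]; exact continuous_apply _

/-- The squash `sq1` is continuous. [folklore] -/
theorem continuous_sq1 : Continuous sq1 := by
  show Continuous (fun y : ℝ => max (-1 : ℝ) (min 1 y))
  exact continuous_const.max (continuous_const.min continuous_id)

/-- Every entry of the toy's flag is a continuous function of the history (strong induction on the birth step: the
entry born at `j` is a polynomial in `v_j` and the squashed older entries). [folklore] -/
theorem continuous_entry_afToy (b₀ ℓ' c ω : ℝ) (k : ℕ) :
    ∀ j, Continuous (fun v : Fin (k + 1) → ℝ => entry (afToy b₀ ℓ' c ω) (extd v) j) := by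
  intro j
  induction j using Nat.strong_induction_on with
  | _ j ih =>
    have e : (fun v : Fin (k + 1) → ℝ => entry (afToy b₀ ℓ' c ω) (extd v) j)
        = fun v => b₀ + (ℓ' * extd v j
            + ∑ m ∈ range j, c * extd v j * ω ^ (j - m) * sq1 (entry (afToy b₀ ℓ' c ω) (extd v) m)) := by
      funext v
      rw [entry_def, afToy_apply]
      congr 2
      exact Finset.sum_congr rfl fun m hm => by rw [flag_apply, if_pos (mem_range.mp hm)]
    rw [e]
    refine continuous_const.add ((continuous_const.mul (continuous_extd k j)).add
      (continuous_finsetSum _ fun m hm => ?_))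
    exact ((continuous_const.mul (continuous_extd k j)).mul continuous_const).mul
      (continuous_sq1.comp (ih m (mem_range.mp hm)))

/-- Hence `BetaContH γ βtoy` (any γ): every `βtoy k` is continuous on (indeed everywhere, a fortiori on) the box.
[folklore] -/
theorem betaContH_afToy (b₀ ℓ' c ω γ : ℝ) : BetaContH γ (βtoy b₀ ℓ' c ω) := fun k =>
  (continuous_entry_afToy b₀ ℓ' c ω k k).continuousOn

end Continuity

/-! ## §3 Asymptotically free INFRARED-PINNED runs of (0.20) for the toy family, for EVERY number of steps -/

section Runs

/-- RUNS EXIST: with `b₀ − cγω(1−ω)⁻¹ ≥ b > 0` the toy family has, for EVERY `K` and EVERY infrared value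
`gIR ∈ ]0, γ]`, a run of (0.20) of length `K` in the box `]0, γ]` pinned at `g_K = gIR` — BY NAME from
`FlowStep.couplingTrajectory_exists_history` (continuity §2, lower/upper bounds §1).  So the run / box / pin binders of
node U2's closures are inhabited by a genuinely asymptotically free family (`β ≥ b > 0` on every box). [folklore] -/
theorem runs_exist {b₀ ℓ' c ω γ b gIR : ℝ} (hγ : 0 < γ) (hb : 0 < b) (hble : b ≤ b₀ - c * γ * (ω / (1 - ω)))
    (hℓ' : 0 ≤ ℓ') (hc : 0 ≤ c) (hω : 0 ≤ ω) (hω1 : ω < 1) (hgIR : 0 < gIR) (hgIRγ : gIR ≤ γ) :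
    ∃ g : ℕ → ℕ → ℝ, (∀ K, RGEqH K (βtoy b₀ ℓ' c ω) (g K)) ∧ (∀ K i, i ≤ K → 0 < g K i ∧ g K i ≤ γ) ∧
      ∀ K, g K K = gIR := by
  have hcγ : 0 ≤ c * γ * (ω / (1 - ω)) := mul_nonneg (mul_nonneg hc hγ.le) (div_nonneg hω (sub_pos.mpr hω1).le)
  have hbβ' : b ≤ b₀ + ℓ' * γ + c * γ * (ω / (1 - ω)) := by nlinarith [mul_nonneg hℓ' hγ.le]
  have h := fun K => couplingTrajectory_exists_history (βtoy b₀ ℓ' c ω) hγ hb hbβ' (betaContH_afToy b₀ ℓ' c ω γ)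
    (betaLowerH_afToy hℓ' hc hω hω1 hble) (betaUpperH_afToy hℓ' hc hω hω1) K gIR hgIR hgIRγ
  choose g hg using h
  exact ⟨g, fun K => (hg K).2.1, fun K => (hg K).2.2.1, fun K => (hg K).1⟩

end Runs

/-! ## §4 END TO END: every binder of `T4TwoRunAfTail.injectedRate_of_fullScheme_primitive_afTail` inhabited at once,
and node U2's output for the toy's pinned asymptotically free runs -/

section EndToEnd

/-- **NON-VACUITY OF NODE U2's AF TWO-RUN CLOSURE (primitive booking).**  For the toy scheme with
`b₀ − cγω(1−ω)⁻¹ ≥ b > 0` (asymptotic freedom), `ℓ′, c ≥ 0`, `0 ≤ ω < 1`, any `ε > 0` and `ν < 1` with `ω ≤ ν`,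
`(1 + ε)ω ≤ ν`, any infrared value `gIR ∈ ]0, γ]`, and the closure's window (verbatim, with `cr = 1`, direct modulus
`ℓ′ + cω(1−ω)⁻¹`, source constant `a = cγω`, source rate `θ = ω`): there is a family of runs of (0.20), one for EVERY
number of steps `K`, all in the box and pinned at `gIR`, whose successive coupling discrepancies satisfy node U2's
output shape `InjectedRate (8·a·Λ/(1−ν)²) 0 ((1+ν)/2)`, `Λ = (1 + cγ)^{k₀ + ⌈c²/(bε²)⌉}` — obtained by feeding
§1–§3 into `T4TwoRunAfTail.injectedRate_of_fullScheme_primitive_afTail` BY NAME.  Every one of that theorem's binders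
(`Represents`, `ReadLipschitz`, `StepDirect`, `StepMemoryFn`, `StepShift`, source rate, runs, box, pin,
`EventualLowerH` with `b > 0`, window) is thereby inhabited SIMULTANEOUSLY, with non-zero memory constant and non-zero
source when `c, ω > 0`.  A CONSISTENCY certificate for unprinted hypothesis SHAPES — the toy is not Bałaban's scheme and
nothing of [Balaban1987RG1] is asserted. [folklore] -/
theorem injectedRate_afToy {b₀ ℓ' c ω γ ε ν b gIR : ℝ} {k₀ : ℕ} (hγ : 0 < γ) (hb : 0 < b)
    (hble : b ≤ b₀ - c * γ * (ω / (1 - ω))) (hℓ' : 0 ≤ ℓ') (hc : 0 ≤ c) (hω : 0 ≤ ω) (hω1 : ω < 1) (hε : 0 < ε)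
    (hν1 : ν < 1) (hων : ω ≤ ν) (hεων : (1 + ε) * ω ≤ ν) (hgIR : 0 < gIR) (hgIRγ : gIR ≤ γ)
    (hwin : 2 * (1 * (ℓ' + c * (ω / (1 - ω))) * (1 + c * γ) ^ (k₀ + ⌈c ^ 2 / (b * ε ^ 2)⌉₊)
      * (((k₀ : ℝ) + 1) * γ ^ 3 + 2 * γ / b)) ≤ 1 - (1 + ε) * ω) :
    ∃ g : ℕ → ℕ → ℝ, (∀ K, RGEqH K (βtoy b₀ ℓ' c ω) (g K)) ∧ (∀ K i, i ≤ K → 0 < g K i ∧ g K i ≤ γ) ∧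
      (∀ K, g K K = gIR) ∧
      T4CauchySum.InjectedRate (8 * 1 * (c * γ * ω) * (1 + c * γ) ^ (k₀ + ⌈c ^ 2 / (b * ε ^ 2)⌉₊) / (1 - ν) ^ 2)
        0 ((1 + ν) / 2) (fun K j => disc (g K) (g (K + 1)) j) := by
  obtain ⟨g, hrun, hbox, hpin⟩ := runs_exist hγ hb hble hℓ' hc hω hω1 hgIR hgIRγ
  have hℓ'' : 0 ≤ ℓ' + c * (ω / (1 - ω)) := add_nonneg hℓ' (mul_nonneg hc (div_nonneg hω (sub_pos.mpr hω1).le))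
  have ha : 0 ≤ c * γ * ω := mul_nonneg (mul_nonneg hc hγ.le) hω
  exact ⟨g, hrun, hbox, hpin,
    injectedRate_of_fullScheme_primitive_afTail g gIR hγ hb hℓ'' hc hω zero_le_one ha hω hε hν1 hων hεων
      (represents_afToy b₀ ℓ' c ω γ) readLipschitz_id (afToy_direct hℓ' hc hω hω1) (afToy_memoryFn hc hω)
      (afToy_shift hc hω) (fun k => le_rfl) hrun hbox hpin (eventualLowerH_afToy hℓ' hc hω hω1 hble k₀) hwin⟩

/-- The same for the ε-GAP form `T4TwoRunAfTail.injectedRate_of_fullScheme_twoRun_afTail` (any rate `ρ < 1` with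
`(1 + ε)ω < ρ`, `ω ≤ ρ`; window with the right-hand side `(1 − (1 + ε)ω)/2`): its binder list is inhabited by the same
toy data, conclusion `InjectedRate (2·a·Λ·ρ/(ρ − (1+ε)ω)·(1 − ρ)⁻¹) 0 ρ`. [folklore] -/
theorem injectedRate_afToy_gap {b₀ ℓ' c ω γ ε ρ b gIR : ℝ} {k₀ : ℕ} (hγ : 0 < γ) (hb : 0 < b)
    (hble : b ≤ b₀ - c * γ * (ω / (1 - ω))) (hℓ' : 0 ≤ ℓ') (hc : 0 ≤ c) (hω : 0 ≤ ω) (hω1 : ω < 1) (hε : 0 < ε)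
    (hρ1 : ρ < 1) (hωρ : ω ≤ ρ) (hgap : (1 + ε) * ω < ρ) (hgIR : 0 < gIR) (hgIRγ : gIR ≤ γ)
    (hwin : 1 * (ℓ' + c * (ω / (1 - ω))) * (1 + c * γ) ^ (k₀ + ⌈c ^ 2 / (b * ε ^ 2)⌉₊)
      * (((k₀ : ℝ) + 1) * γ ^ 3 + 2 * γ / b) ≤ (1 - (1 + ε) * ω) / 2) :
    ∃ g : ℕ → ℕ → ℝ, (∀ K, RGEqH K (βtoy b₀ ℓ' c ω) (g K)) ∧ (∀ K i, i ≤ K → 0 < g K i ∧ g K i ≤ γ) ∧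
      (∀ K, g K K = gIR) ∧
      T4CauchySum.InjectedRate
        (2 * (1 * ((c * γ * ω) * ((1 + c * γ) ^ (k₀ + ⌈c ^ 2 / (b * ε ^ 2)⌉₊) * (ρ / (ρ - (1 + ε) * ω)))))
          / (1 - ρ)) 0 ρ (fun K j => disc (g K) (g (K + 1)) j) := by
  obtain ⟨g, hrun, hbox, hpin⟩ := runs_exist hγ hb hble hℓ' hc hω hω1 hgIR hgIRγ
  have hℓ'' : 0 ≤ ℓ' + c * (ω / (1 - ω)) := add_nonneg hℓ' (mul_nonneg hc (div_nonneg hω (sub_pos.mpr hω1).le))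
  have ha : 0 ≤ c * γ * ω := mul_nonneg (mul_nonneg hc hγ.le) hω
  have hsrc : ∀ k, c * γ * ω * ω ^ k ≤ c * γ * ω * ρ ^ k := fun k =>
    mul_le_mul_of_nonneg_left (pow_le_pow_left₀ hω hωρ k) ha
  exact ⟨g, hrun, hbox, hpin,
    injectedRate_of_fullScheme_twoRun_afTail g gIR hγ hb hρ1 hℓ'' hc hω zero_le_one ha hε hgap
      (represents_afToy b₀ ℓ' c ω γ) readLipschitz_id (afToy_direct hℓ' hc hω hω1) (afToy_memoryFn hc hω)
      (afToy_shift hc hω) hsrc hrun hbox hpin (eventualLowerH_afToy hℓ' hc hω hω1 hble k₀) hwin⟩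

/-- **THE WINDOW IS NON-EMPTY — EXPLICIT RATIONALS.**  With `(b₀, ℓ′, c, ω, ε, ν, b, k₀) = (1/2, 1/6, 1/2, 1/4, 1, 1/2,
1/4, 0)`: for EVERY `γ ∈ ]0, 1/16]` and EVERY `gIR ∈ ]0, γ]` all hypotheses of `injectedRate_afToy` hold
(`⌈c²/(bε²)⌉ = 1`, `Λ = 1 + γ/2`, window `(2/3)(1 + γ/2)(γ³ + 8γ) ≤ 1/2`), and node U2's output reads
`InjectedRate (5γ) 0 (3/4)` for the toy's pinned asymptotically free runs (`4γΛ ≤ 5γ`).  In this regime the entries lie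
in `]0, 1[` (no saturation of `sq1`), so the toy family is GENUINELY history-dependent (§5). [folklore] -/
theorem injectedRate_afToy_numeric {γ gIR : ℝ} (hγ : 0 < γ) (hγ16 : γ ≤ 1 / 16) (hgIR : 0 < gIR) (hgIRγ : gIR ≤ γ) :
    ∃ g : ℕ → ℕ → ℝ, (∀ K, RGEqH K (βtoy (1 / 2) (1 / 6) (1 / 2) (1 / 4)) (g K)) ∧
      (∀ K i, i ≤ K → 0 < g K i ∧ g K i ≤ γ) ∧ (∀ K, g K K = gIR) ∧
      T4CauchySum.InjectedRate (5 * γ) 0 (3 / 4) (fun K j => disc (g K) (g (K + 1)) j) := by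
  have hceil : ⌈((1 : ℝ) / 2) ^ 2 / ((1 / 4) * (1 : ℝ) ^ 2)⌉₊ = 1 := by
    rw [show ((1 : ℝ) / 2) ^ 2 / ((1 / 4) * (1 : ℝ) ^ 2) = 1 by norm_num, Nat.ceil_one]
  have hble : (1 : ℝ) / 4 ≤ 1 / 2 - 1 / 2 * γ * ((1 / 4) / (1 - 1 / 4)) := by norm_num; linarith
  have hwin : 2 * (1 * ((1 : ℝ) / 6 + 1 / 2 * ((1 / 4) / (1 - 1 / 4))) * (1 + 1 / 2 * γ) ^ (0 + ⌈((1 : ℝ) / 2) ^ 2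
      / ((1 / 4) * (1 : ℝ) ^ 2)⌉₊) * ((((0 : ℕ) : ℝ) + 1) * γ ^ 3 + 2 * γ / (1 / 4))) ≤ 1 - (1 + 1) * (1 / 4) := by
    rw [hceil]
    have h3 : γ ^ 3 ≤ γ / 256 := by nlinarith [mul_pos hγ hγ]
    norm_num
    nlinarith [h3]
  obtain ⟨g, hrun, hbox, hpin, hrate⟩ := injectedRate_afToy (b₀ := 1 / 2) (ℓ' := 1 / 6) (c := 1 / 2) (ω := 1 / 4)
    (ε := 1) (ν := 1 / 2) (b := 1 / 4) (k₀ := 0) hγ (by norm_num) hble (by norm_num) (by norm_num) (by norm_num)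
    (by norm_num) (by norm_num) (by norm_num) (by norm_num) (by norm_num) hgIR hgIRγ hwin
  refine ⟨g, hrun, hbox, hpin, ?_⟩
  have hC : 8 * 1 * (1 / 2 * γ * (1 / 4)) * (1 + 1 / 2 * γ) ^ (0 + ⌈((1 : ℝ) / 2) ^ 2 / ((1 / 4) * (1 : ℝ) ^ 2)⌉₊)
      / (1 - 1 / 2) ^ 2 ≤ 5 * γ := by
    rw [hceil]
    norm_num
    nlinarith
  have hθ : (1 + (1 : ℝ) / 2) / 2 = 3 / 4 := by norm_num
  rw [hθ] at hrate
  exact injectedRate_mono_const hrate hC (by norm_num)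

end EndToEnd

/-! ## §5 NON-TRIVIALITY: the discrepancies the closure controls are not the zero sequence, and the toy family is
genuinely history-dependent -/

section NonTriviality

/-- `sq1 y > 0` for `y > 0`. [folklore] -/
theorem sq1_pos {y : ℝ} (hy : 0 < y) : 0 < sq1 y :=
  lt_of_lt_of_le (lt_min one_pos hy) (le_max_right _ _)

/-- `sq1 y = y` on `[−1, 1]`. [folklore] -/
theorem sq1_eq_self {y : ℝ} (h1 : -1 ≤ y) (h2 : y ≤ 1) : sq1 y = y := by
  show max (-1 : ℝ) (min 1 y) = y
  rw [min_eq_right h2, max_eq_right h1]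

/-- The first β-function of the toy: `βtoy 0 (g_0) = b₀ + ℓ′g_0` (no older entries). [folklore] -/
theorem βtoy_zero (b₀ ℓ' c ω : ℝ) (G : ℕ → ℝ) : βtoy b₀ ℓ' c ω 0 (prefixOf G 0) = b₀ + ℓ' * G 0 := by
  show entry (afToy b₀ ℓ' c ω) (extd (prefixOf G 0)) 0 = _
  rw [entry_def, afToy_apply, Finset.sum_range_zero, add_zero, extd_prefixOf le_rfl]

/-- The second β-function of the toy: `βtoy 1 (g_0, g_1) = b₀ + ℓ′g_1 + c·g_1·ω·sq1(b₀ + ℓ′g_0)` — it DEPENDS ON THE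
OLDER COUPLING `g_0` (genuine history dependence, through the entry born at step 0). [folklore] -/
theorem βtoy_one (b₀ ℓ' c ω : ℝ) (G : ℕ → ℝ) :
    βtoy b₀ ℓ' c ω 1 (prefixOf G 1) = b₀ + (ℓ' * G 1 + c * G 1 * ω * sq1 (b₀ + ℓ' * G 0)) := by
  show entry (afToy b₀ ℓ' c ω) (extd (prefixOf G 1)) 1 = _
  rw [entry_def, afToy_apply, Finset.sum_range_one, flag_apply, if_pos zero_lt_one, entry_def, afToy_apply,
    Finset.sum_range_zero, add_zero, extd_prefixOf zero_le_one, extd_prefixOf le_rfl, Nat.sub_zero, pow_one]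

/-- **THE SUBJECT OF THE CONCLUSION IS NOT ZERO.**  For ANY family of runs of (0.20) of the toy family in the box and
pinned at one infrared value (the run / box / pin binders of node U2's closures), with `b₀ > 0`, `ℓ′ ≥ 0`, `c, ω > 0`,
the discrepancy between run A with one step and run B with two steps at the finest common scale is STRICTLY POSITIVE:
`disc (g 1) (g 2) 0 > 0`.  (Run B's second β-function carries the memory term `c·g·ω·sq1(entry 0) > 0` that run A's
first does not; `1/x²` is strictly decreasing.)  So `InjectedRate` in §4 bounds a non-zero sequence. [folklore] -/
theorem disc_pos {b₀ ℓ' c ω γ gIR : ℝ} (hb₀ : 0 < b₀) (hℓ' : 0 ≤ ℓ') (hc : 0 < c) (hω : 0 < ω)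
    {g : ℕ → ℕ → ℝ} (hrun : ∀ K, RGEqH K (βtoy b₀ ℓ' c ω) (g K))
    (hbox : ∀ K i, i ≤ K → 0 < g K i ∧ g K i ≤ γ) (hpin : ∀ K, g K K = gIR) : 0 < disc (g 1) (g 2) 0 := by
  have hA := hrun 1 0 zero_lt_one
  have hB := hrun 2 1 one_lt_two
  rw [βtoy_zero] at hA
  rw [βtoy_one] at hB
  simp only [zero_add] at hA
  have hxA : 0 < g 1 0 := (hbox 1 0 zero_le_one).1
  have hxB : 0 < g 2 1 := (hbox 2 1 one_le_two).1
  have hx0 : 0 < g 2 0 := (hbox 2 0 (by norm_num)).1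
  have hp : g 1 1 = g 2 2 := (hpin 1).trans (hpin 2).symm
  have hs : 0 < sq1 (b₀ + ℓ' * g 2 0) := sq1_pos (by nlinarith [mul_nonneg hℓ' hx0.le])
  have key : 1 / (g 2 1) ^ 2 - 1 / (g 1 0) ^ 2 = ℓ' * (g 2 1 - g 1 0) + c * g 2 1 * ω * sq1 (b₀ + ℓ' * g 2 0) := by
    rw [hp] at hA
    linarith
  have hmem : 0 < c * g 2 1 * ω * sq1 (b₀ + ℓ' * g 2 0) := by positivity
  have hD : 0 < 1 / (g 2 1) ^ 2 - 1 / (g 1 0) ^ 2 := by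
    by_contra hle
    have h1 : 1 / (g 2 1) ^ 2 ≤ 1 / (g 1 0) ^ 2 := by linarith [not_lt.mp hle]
    have h2 : (g 1 0) ^ 2 ≤ (g 2 1) ^ 2 := (one_div_le_one_div (pow_pos hxB 2) (pow_pos hxA 2)).mp h1
    have h3 : g 1 0 ≤ g 2 1 := (pow_le_pow_iff_left₀ hxA.le hxB.le two_ne_zero).mp h2
    have h4 : 0 ≤ ℓ' * (g 2 1 - g 1 0) := mul_nonneg hℓ' (sub_nonneg.mpr h3)
    linarith
  show 0 < |1 / (g 1 0) ^ 2 - 1 / (g 2 (0 + 1)) ^ 2|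
  rw [zero_add, abs_sub_comm]
  exact abs_pos.mpr (ne_of_gt hD)

/-- **GENUINE HISTORY DEPENDENCE** (no saturation): if `0 < b₀` and `b₀ + ℓ′γ ≤ 1` then on the box the second
β-function is `βtoy 1 (g_0, g_1) = b₀ + ℓ′g_1 + cω·g_1·(b₀ + ℓ′g_0)` — AFFINE AND STRICTLY INCREASING IN THE OLDER
COUPLING `g_0` when `ℓ′, c, ω > 0`: two histories with the same newest coupling and different older couplings have
different β.  The toy is NOT a Markov family in disguise. [folklore] -/
theorem βtoy_one_strictMono {b₀ ℓ' c ω γ : ℝ} (hb₀ : 0 < b₀) (hsat : b₀ + ℓ' * γ ≤ 1) (hℓ' : 0 < ℓ') (hc : 0 < c)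
    (hω : 0 < ω) {G G' : ℕ → ℝ} (hG : ∀ i, i ≤ 1 → 0 < G i ∧ G i ≤ γ) (hG' : ∀ i, i ≤ 1 → 0 < G' i ∧ G' i ≤ γ)
    (h1 : G 1 = G' 1) (h0 : G 0 < G' 0) :
    βtoy b₀ ℓ' c ω 1 (prefixOf G 1) < βtoy b₀ ℓ' c ω 1 (prefixOf G' 1) := by
  rw [βtoy_one, βtoy_one, h1]
  have e1 : sq1 (b₀ + ℓ' * G 0) = b₀ + ℓ' * G 0 := sq1_eq_self (by nlinarith [mul_nonneg hℓ'.le (hG 0 zero_le_one).1.le])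
    (by nlinarith [mul_le_mul_of_nonneg_left (hG 0 zero_le_one).2 hℓ'.le])
  have e2 : sq1 (b₀ + ℓ' * G' 0) = b₀ + ℓ' * G' 0 :=
    sq1_eq_self (by nlinarith [mul_nonneg hℓ'.le (hG' 0 zero_le_one).1.le])
      (by nlinarith [mul_le_mul_of_nonneg_left (hG' 0 zero_le_one).2 hℓ'.le])
  rw [e1, e2]
  have hx : 0 < G' 1 := (hG' 1 le_rfl).1
  have : c * G' 1 * ω * (b₀ + ℓ' * G 0) < c * G' 1 * ω * (b₀ + ℓ' * G' 0) :=
    mul_lt_mul_of_pos_left (by nlinarith) (by positivity)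
  linarith

end NonTriviality

/-! ## §6 The binder list of `T4TwoRunAfTail.injectedRate_of_fullScheme_primitive_afTail`, inhabited AT ONCE with
strictly positive memory constant, source, asymptotic-freedom constant and discrepancy -/

section Inhabited

/-- **EVERY BINDER OF NODE U2's AF TWO-RUN CLOSURE, SIMULTANEOUSLY, ON ASYMPTOTICALLY FREE PINNED RUNS.**  There exist a
history-dependent family `β`, a scheme `Φ` on `X = ℝ` with read-out `r`, a source `src`, constants and a family of runs
`g` with one infrared value `gIR` such that ALL hypotheses of
`T4TwoRunAfTail.injectedRate_of_fullScheme_primitive_afTail` hold — the numeric side conditions, `Represents`,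
`ReadLipschitz`, `StepDirect`, `StepMemoryFn Φ γ (c·) ω`, `StepShift`, the source rate, the runs of (0.20) for every
`K`, the box, the pin, `EventualLowerH b γ k₀ β`, the window — with, IN ADDITION, `c > 0` (non-zero memory), `src k > 0`
for all `k` (non-zero scale-shift source), `b > 0` (asymptotic freedom) and `disc (g 1) (g 2) 0 > 0` (the controlled
discrepancies are not the zero sequence).  Witness: §1–§5 at `(b₀, ℓ′, c, ω, ε, ν, b, k₀, γ, gIR) = (1/2, 1/6, 1/2, 1/4,
1, 1/2, 1/4, 0, 1/16, 1/16)`.  After cell GAPS G-t4r3-1 (a hypothesis list of this node that was EMPTY on asymptotically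
free runs) this is the consistency certificate the closure owed; it says nothing about WHICH constants Bałaban's scheme
(2.13) realises (unprinted; cell GAPS G-t4-U2R-2). [folklore] -/
theorem closure_binders_inhabited :
    ∃ (β : HBeta) (Φ : ℕ → ℝ → (ℕ → ℝ) → ℝ) (r : ℝ → ℝ) (src : ℕ → ℝ) (ℓ' c ω γ cr a θ ν b ε : ℝ) (k₀ : ℕ)
      (g : ℕ → ℕ → ℝ) (gIR : ℝ),
      0 < γ ∧ 0 < b ∧ 0 ≤ ℓ' ∧ 0 < c ∧ 0 ≤ ω ∧ 0 ≤ cr ∧ 0 ≤ a ∧ 0 ≤ θ ∧ 0 < ε ∧ ν < 1 ∧ θ ≤ ν ∧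
      (1 + ε) * ω ≤ ν ∧
      Represents Φ r γ β ∧ ReadLipschitz r cr ∧ StepDirect Φ ℓ' γ ∧ StepMemoryFn Φ γ (fun x => c * x) ω ∧
      StepShift Φ γ src ∧ (∀ k, src k ≤ a * θ ^ k) ∧ (∀ k, 0 < src k) ∧
      (∀ K, RGEqH K β (g K)) ∧ (∀ K i, i ≤ K → 0 < g K i ∧ g K i ≤ γ) ∧ (∀ K, g K K = gIR) ∧
      EventualLowerH b γ k₀ β ∧
      2 * (cr * ℓ' * (1 + c * γ) ^ (k₀ + ⌈c ^ 2 / (b * ε ^ 2)⌉₊) * (((k₀ : ℝ) + 1) * γ ^ 3 + 2 * γ / b))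
        ≤ 1 - (1 + ε) * ω ∧
      0 < disc (g 1) (g 2) 0 := by
  have hγ : (0 : ℝ) < 1 / 16 := by norm_num
  have hble : (1 : ℝ) / 4 ≤ 1 / 2 - 1 / 2 * (1 / 16) * ((1 / 4) / (1 - 1 / 4)) := by norm_num
  obtain ⟨g, hrun, hbox, hpin⟩ := runs_exist (b₀ := 1 / 2) (ℓ' := 1 / 6) (c := 1 / 2) (ω := 1 / 4) (b := 1 / 4)
    (gIR := 1 / 16) hγ (by norm_num) hble (by norm_num) (by norm_num) (by norm_num) (by norm_num) hγ le_rfl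
  have hceil : ⌈((1 : ℝ) / 2) ^ 2 / ((1 / 4) * (1 : ℝ) ^ 2)⌉₊ = 1 := by
    rw [show ((1 : ℝ) / 2) ^ 2 / ((1 / 4) * (1 : ℝ) ^ 2) = 1 by norm_num, Nat.ceil_one]
  refine ⟨βtoy (1 / 2) (1 / 6) (1 / 2) (1 / 4), afToy (1 / 2) (1 / 6) (1 / 2) (1 / 4), fun x => x,
    fun k => 1 / 2 * (1 / 16) * (1 / 4) * (1 / 4) ^ k, 1 / 6 + 1 / 2 * ((1 / 4) / (1 - 1 / 4)), 1 / 2, 1 / 4, 1 / 16,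
    1, 1 / 2 * (1 / 16) * (1 / 4), 1 / 4, 1 / 2, 1 / 4, 1, 0, g, 1 / 16, hγ, by norm_num, by norm_num, by norm_num,
    by norm_num, zero_le_one, by norm_num, by norm_num, by norm_num, by norm_num, by norm_num, by norm_num,
    represents_afToy _ _ _ _ _, readLipschitz_id, afToy_direct (by norm_num) (by norm_num) (by norm_num) (by norm_num),
    afToy_memoryFn (by norm_num) (by norm_num), afToy_shift (by norm_num) (by norm_num), fun k => le_rfl,
    fun k => by positivity, hrun, hbox, hpin,
    eventualLowerH_afToy (by norm_num) (by norm_num) (by norm_num) (by norm_num) hble 0, ?_,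
    disc_pos (by norm_num) (by norm_num) (by norm_num) (by norm_num) hrun hbox hpin⟩
  rw [hceil]
  norm_num

end Inhabited

end Literature.MathematicalPhysics.QuantumFieldTheory.Balaban1983to89.T4TwoRunWitnessAF
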